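import Summits.CriticalPhenomena.PercolationContinuityZ3.Theorems.SahiMasterFamilyTerminalIff
import Summits.CriticalPhenomena.PercolationContinuityZ3.Theorems.SahiMasterFamilyPCDBridge
import Summits.CriticalPhenomena.PercolationContinuityZ3.Theorems.SahiMasterFamilyTopCriterion
import Summits.CriticalPhenomena.PercolationContinuityZ3.Theorems.SahiMasterFamilyTerminal

/-!
# The cap dichotomy: (EQI-k) from "every terminal family has a principal cap or a non-splitting top corner"

Unit `prim-masterthm-p4` (gen 9), crux anchor stmt-CriticalPhenomena-4575.  Seat documents HOME/prim-masterthm-p4/CORED-TERMINAL.md.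

The tree already contains, for EVERY order, two detectors of `E_k ≢ 0` for families of increasing events under product measures:
* the PRINCIPAL-CAP DICHOTOMY (gen 6, `SahiSparseEnd.sahiE_eq_zero_iff_suppZeroFlag_of_principalCap`): if `⋂_j U_j` is a cylinder
  `↑c` then `E_k ≡ 0` on the open cube iff `U ∈ Z_k`;
* the TOP CRITERION (gen 7, `SahiSparseEnd.not_forall_interior_sahiE_eq_zero_of_noSplit`): an inclusion-minimal double-failure set that does
  not split forces `E_k ≢ 0`;
and prim-master-conj's reduction `masterFamilyIdentEqIff_iff_terminal_all` ((EQI-(n+3)) ⟺ terminal families are non-vanishing).  This file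
combines them: **if every terminal family of order `n+3` with no sure member has a principal cap or a non-splitting top corner
(`CapDichotomy n`) — and (EQI-(n+2)) holds, to dispose of sure members — then `MasterFamilyIdentEqIff (n+3)`**
(`masterFamilyIdentEqIff_of_capDichotomy`); at order four the lower-order hypothesis is the tree's theorem `masterFamilyIdentEqIff_three`
(`masterFamilyIdentEqIff_four_of_capDichotomy`).

`CapDichotomy 1` is OUR CONJECTURE (a statement, never a fact).  EVIDENCE (exact, exhaustive; seat engine code/c/corefree.c, term5full.c,
kit j103141): every terminal quadruple of increasing events on `{0,1}^4` (477 multisets / 26 classes) and on `{0,1}^5` (exhaustive gluing census,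
1.0·10⁹ candidates) has `⋂_j U_j = {⊤}` — every coordinate lies in the core of exactly one member — hence a principal cap; on `{0,1}^3` the one
terminal quadruple without principal cap, `(x∨y, x∨z, y∨z, x∨y∨z)`, has the non-splitting top corner `{x,y,z}`.  So the (EQI-4) endgame is reduced to
one combinatorial statement about the faces of `Z_4`.  HONEST FRAMING: Sahi `C_k`, Kahn's Conj. 5 and the master theorem remain OPEN; (EQI-4) is
open; nothing here is claimed beyond the kernel. [this work]
-/

noncomputable section

open scoped Classical

namespace Summit.CriticalPhenomena.PercolationContinuityZ3.Theorems

open Finset Function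
open Literature.Combinatorics.Sahi2008
open Literature.Probability.LatticeModels.Kahn2022 (Affects)
open Literature.Probability.Percolation (DeterminedBy)
open Literature.Probability.Percolation.DecisionTree (ind)
open SahiSparseEnd (doubly reflFam toFinsetFam NoSplit)

variable {ι : Type} [Fintype ι]

/-- A family has a PRINCIPAL CAP: the common part `⋂_j U_j` is a cylinder `{T | ↑c ⊆ T}`. [this work] -/
def HasPrincipalCap {k : ℕ} (U : Fin k → Set (Set ι)) : Prop :=
  ∃ c : Finset ι, ∀ T : Set ι, (∀ j, T ∈ U j) ↔ (↑c : Set ι) ⊆ T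

/-- A family has a NON-SPLITTING TOP CORNER: an inclusion-minimal double-failure set of its finset form with no split. [this work] -/
def HasNoSplitTopCorner {k : ℕ} (U : Fin k → Set (Set ι)) : Prop :=
  ∃ c : Finset ι, c ∈ doubly (reflFam (toFinsetFam U)) ∧
    (∀ b, b ∈ doubly (reflFam (toFinsetFam U)) → b ⊆ c → b = c) ∧ NoSplit (toFinsetFam U) c

/-- **The cap dichotomy at order `n + 3`** (OUR CONJECTURE at order 4; a statement, never a fact): every terminal family of `n + 3`
increasing events with no sure member — no `Z_{n+2}` sub-family, no common pivotal coordinate, no private coordinate, all single-coordinate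
minors in `Z_{n+3}` — has a principal cap or a non-splitting top corner.  Exhaustive census at order 4 on `{0,1}^n`, `n ≤ 5`: no exception
(seat docs CORED-TERMINAL.md). [this work] [status: open] -/
@[conjecture] def CapDichotomy (n : ℕ) : Prop :=
  ∀ (ι : Type) [Fintype ι] (U : Fin (n + 3) → Set (Set ι)) (S : Finset ι), (∀ j, IsUpperSet (U j)) →
    (∀ j, (∅ : Set ι) ∉ U j) →
    (∀ j, DeterminedBy (U j) (↑S : Set ι)) →
    (∀ m : Fin (n + 3), ¬ SuppZeroFlag (n + 2) (fun j => U (m.succAbove j))) →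
    (¬ ∃ e : ι, ∀ j, ∃ ω, e ∉ ω ∧ ω ∉ U j ∧ insert e ω ∈ U j) →
    (¬ ∃ e : ι, ∃ c : Fin (n + 3), (∃ ω, e ∉ ω ∧ ω ∉ U c ∧ insert e ω ∈ U c) ∧ ∀ j, j ≠ c → ¬ Affects (U j) e) →
    (∀ e ∈ S, ∀ b : Bool, SuppZeroFlag (n + 3) (fun j => secAt e b (U j))) →
      HasPrincipalCap U ∨ HasNoSplitTopCorner U

omit [Fintype ι] in
/-- A nonempty increasing event contains the full configuration. [folklore] -/
theorem univ_mem_of_isUpperSet_of_ne_empty {A : Set (Set ι)} (hA : IsUpperSet A) (hne : A ≠ ∅) :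
    (Set.univ : Set ι) ∈ A := by
  obtain ⟨ω, hω⟩ := Set.nonempty_iff_ne_empty.2 hne
  exact hA (Set.subset_univ ω) hω

/-- A family with an empty member is a zero flag, so a family with no zero sub-family of size `n + 2` has no empty member. [this work] -/
theorem ne_empty_of_no_zero_subfamily {n : ℕ} (U : Fin (n + 3) → Set (Set ι))
    (hno : ∀ m : Fin (n + 3), ¬ SuppZeroFlag (n + 2) (fun j => U (m.succAbove j))) (j : Fin (n + 3)) : U j ≠ ∅ := by
  intro hj
  -- delete a member other than `j`; the deleted family still contains the empty member
  obtain ⟨m, hm⟩ : ∃ m : Fin (n + 3), m ≠ j := ⟨j + 1, by simp⟩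
  obtain ⟨l, hl⟩ := Fin.exists_succAbove_eq hm.symm
  exact hno m (suppZeroFlag_of_mem_empty (n + 1) (fun i => U (m.succAbove i)) l (by rw [hl]; exact hj))

/-- **A sure member peels off**: if `U_i = univ` then `E_{n+2}(μ_p; 1_U) = n · E_{n+1}(μ_p; 1_{U_{−i}})`. [this work] -/
theorem sahiE_eq_of_mem_univ {n : ℕ} (p : ι → unitInterval) (U : Fin (n + 2) → Set (Set ι)) (i : Fin (n + 2))
    (hi : U i = Set.univ) :
    sahiE (bernoulliWeight p) (n + 2) (fun j => ind (U j)) =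
      n * sahiE (bernoulliWeight p) (n + 1) (fun j => ind (U (i.succAbove j))) := by
  rw [sahiE_peel (bernoulliWeight p) n (fun j => ind (U j)) i]
  have h1 : ind (U i) = 1 := by rw [hi]; exact ind_univ_eq_one
  have hupd : ∀ l : Fin (n + 1),
      update (fun j => ind (U (i.succAbove j))) l (ind (U (i.succAbove l)) * ind (U i)) =
        fun j => ind (U (i.succAbove j)) := by
    intro l
    rw [h1, mul_one]
    exact update_eq_self l _
  simp only [hupd, sum_const, card_univ, Fintype.card_fin, nsmul_eq_mul]
  rw [h1, ex_one (sum_bernoulliWeight p)]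
  push_cast
  ring

/-- **(EQI-(n+3)) from the cap dichotomy** (and (EQI-(n+2)) for families with a sure member). [this work] -/
theorem masterFamilyIdentEqIff_of_capDichotomy (n : ℕ) (hlow : MasterFamilyIdentEqIff (n + 2)) (h : CapDichotomy n) :
    MasterFamilyIdentEqIff (n + 3) := by
  refine (masterFamilyIdentEqIff_iff_terminal_all n).2 ?_
  intro ι _ U S hU hS hno hncp hnpriv hmin
  -- no member is empty
  have hne : ∀ j, U j ≠ ∅ := ne_empty_of_no_zero_subfamily U hno
  by_cases hsure : ∃ i, U i = Set.univ
  · -- a sure member: `E_{n+3} = (n+1) · E_{n+2}(U_{−i})`, and `U_{−i} ∉ Z_{n+2}` is non-vanishing by (EQI-(n+2))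
    obtain ⟨i, hi⟩ := hsure
    have hUi : ∀ j, IsUpperSet (U (i.succAbove j)) := fun j => hU _
    have hnz : ¬ ∀ p : ι → unitInterval, (∀ e, (p e : ℝ) ∈ Set.Ioo (0 : ℝ) 1) →
        sahiE (bernoulliWeight p) (n + 2) (fun j => ind (U (i.succAbove j))) = 0 :=
      fun hall => hno i ((hlow ι (fun j => U (i.succAbove j)) hUi).1 hall)
    push Not at hnz
    obtain ⟨p, hp, hpne⟩ := hnz
    refine ⟨p, hp, ?_⟩
    rw [sahiE_eq_of_mem_univ p U i hi]
    exact mul_ne_zero (by exact_mod_cast Nat.succ_ne_zero n) hpne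
  · push Not at hsure
    have h0 : ∀ j, (∅ : Set ι) ∉ U j := by
      intro j h0j
      exact hsure j (Set.eq_univ_of_forall fun ω => hU j (Set.empty_subset ω) h0j)
    rcases h ι U S hU h0 hS hno hncp hnpriv hmin with ⟨c, hc⟩ | ⟨c, hc, hcmin, hns⟩
    · -- principal cap: PCD says `E ≡ 0 ⟺ U ∈ Z_{n+3}`, and `Z_{n+3}` needs a `Z_{n+2}` sub-family
      by_contra hall
      push Not at hall
      have hall' : ∀ p : ι → unitInterval, (∀ e, (p e : ℝ) ∈ Set.Ioo (0 : ℝ) 1) →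
          sahiE (bernoulliWeight p) (n + 2 + 1) (fun j => ind (U j)) = 0 := fun p hp => hall p hp
      have hZ : SuppZeroFlag (n + 2 + 1) U :=
        (SahiSparseEnd.sahiE_eq_zero_iff_suppZeroFlag_of_principalCap U hU h0 c hc).1 hall'
      obtain ⟨i, hi, -⟩ := hZ
      exact hno i hi
    · -- non-splitting top corner: TOP CRITERION
      have huniv : ∀ j, (Set.univ : Set ι) ∈ U j := fun j => univ_mem_of_isUpperSet_of_ne_empty (hU j) (hne j)
      have := SahiSparseEnd.not_forall_interior_sahiE_eq_zero_of_noSplit U hU huniv c hc hcmin hns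
      push Not at this
      exact this

/-- **(EQI-4) from the cap dichotomy at order four** (the lower-order hypothesis is the tree's theorem (EQI-3)). [this work] -/
theorem masterFamilyIdentEqIff_four_of_capDichotomy (h : CapDichotomy 1) : MasterFamilyIdentEqIff 4 :=
  masterFamilyIdentEqIff_of_capDichotomy 1 masterFamilyIdentEqIff_three h


/-! ### Cores: the principal-cap branch from "every essential coordinate empties a member"

For a family of nonempty increasing events, coordinate `e` lies in the CORE of `U_j` (every minimal configuration of `U_j` contains `e`) iff the
`0`-section `U_j^{e←0}` is empty — and then the `0`-face `U^{e←0}` is a zero flag for the trivial reason.  If every coordinate of a set `c` empties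
some member and no coordinate outside `c` affects any member, the common part `⋂_j U_j` is the cylinder `↑c`: the family has a principal cap.  This is
the form in which the seat's census verifies `CapDichotomy 1` (every terminal quadruple on `{0,1}^n`, `n = 4, 5`, has every essential coordinate in the
core of exactly one member). [this work] -/

omit [Fintype ι] in
/-- `U^{e←0} = ∅` means: no configuration avoiding `e` lies in `U`. [this work] -/
theorem not_mem_of_secAt_false_eq_empty {e : ι} {A : Set (Set ι)} (h : secAt e false A = ∅) {ω : Set ι} (hω : e ∉ ω) :
    ω ∉ A := by
  intro hA
  have : ω ∈ secAt e false A := by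
    rw [mem_secAt]
    simpa [forceAt, Set.sdiff_singleton_eq_self hω] using hA
  rw [h] at this
  exact this

omit [Fintype ι] in
/-- Removing finitely many non-affecting coordinates from the full configuration keeps membership in an increasing event. [this work] -/
theorem diff_mem_of_forall_not_affects {A : Set (Set ι)} (hA : IsUpperSet A) (huniv : (Set.univ : Set ι) ∈ A)
    (T : Finset ι) (hT : ∀ e ∈ T, ¬ Affects A e) : (Set.univ \ (↑T : Set ι)) ∈ A := by
  induction T using Finset.induction_on with
  | empty => simpa using huniv
  | @insert a T ha ih =>
    have hT' : ∀ e ∈ T, ¬ Affects A e := fun e he => hT e (Finset.mem_insert_of_mem he)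
    have hmem := ih hT'
    have hins : insert a (Set.univ \ (↑(insert a T) : Set ι)) = Set.univ \ (↑T : Set ι) := by
      ext x
      by_cases hxa : x = a
      · subst hxa; simp [ha]
      · simp [hxa]
    have := (insert_mem_iff_of_not_affects hA (hT a (Finset.mem_insert_self a T)) (Set.univ \ (↑(insert a T) : Set ι))).1
    exact this (by rw [hins]; exact hmem)

/-- **Cores give a principal cap.**  If every coordinate of `c` empties some member (`U_j^{e←0} = ∅`) and no coordinate outside `c` affects any member,
then `⋂_j U_j = ↑c`. [this work] -/
theorem hasPrincipalCap_of_cores {k : ℕ} (U : Fin k → Set (Set ι)) (hU : ∀ j, IsUpperSet (U j)) (huniv : ∀ j, (Set.univ : Set ι) ∈ U j)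
    (c : Finset ι) (hcore : ∀ e ∈ c, ∃ j, secAt e false (U j) = ∅) (hfree : ∀ e, e ∉ c → ∀ j, ¬ Affects (U j) e) :
    HasPrincipalCap U := by
  refine ⟨c, fun T => ⟨fun hT e he => ?_, fun hcT j => ?_⟩⟩
  · by_contra heT
    obtain ⟨j, hj⟩ := hcore e he
    exact not_mem_of_secAt_false_eq_empty hj heT (hT j)
  · -- `T ⊇ c`: remove the (finitely many) coordinates of `Tᶜ ⊆ cᶜ` from `univ`
    classical
    set R : Finset ι := Finset.univ.filter fun x => x ∉ T with hR
    have hRT : (Set.univ \ (↑R : Set ι)) = T := by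
      ext x; simp [hR]
    have hRfree : ∀ e ∈ R, ¬ Affects (U j) e := by
      intro e he
      have hxT : e ∉ T := by simpa [hR] using he
      exact hfree e (fun hec => hxT (hcT hec)) j
    have := diff_mem_of_forall_not_affects (hU j) (huniv j) R hRfree
    rwa [hRT] at this


/-! ### All orders from the cap dichotomy at every order

Induction on the order from the tree's (EQI-3): if `CapDichotomy m` holds for every `1 ≤ m ≤ n` then `MasterFamilyIdentEqIff (n + 3)`.  Census (seat
engine code-g9/termk.c, HOME CORED-TERMINAL.md §4): at order five every terminal family on `{0,1}^4` (1 101 classes, exhaustive) has every coordinate in the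
core of exactly one member, and on `{0,1}^3` the one exception `(x∨y, x∨z, y∨z, x∨y∨z, x∨y∨z)` has the non-splitting top corner `{x,y,z}` — so
`CapDichotomy 2` is census-exact there too.  OUR CONJECTURE (CAP): `CapDichotomy m` for every `m`. [this work] -/

/-- **(EQI-(n+3)) from the cap dichotomy at all orders `4, …, n+3`.** [this work] -/
theorem masterFamilyIdentEqIff_of_capDichotomy_all (n : ℕ) (h : ∀ m, 1 ≤ m → m ≤ n → CapDichotomy m) :
    MasterFamilyIdentEqIff (n + 3) := by
  induction n with
  | zero => exact masterFamilyIdentEqIff_three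
  | succ n ih =>
    exact masterFamilyIdentEqIff_of_capDichotomy (n + 1)
      (ih fun m h1 hm => h m h1 (hm.trans (Nat.le_succ n))) (h (n + 1) (Nat.succ_pos n) le_rfl)


/-! ### The face-free form: core rigidity

A terminal family with `E_k ≡ 0` on the open cube carries, at every coordinate, the vanishing of all top `p_e`-coefficients (THEOREM R's trivial form
at `(k−1)`-shared coordinates, the `(k−2)`-detector, …).  The seat's census (PROOF-CAP-NOTES.md §6: exhaustive on `{0,1}^4`, and on `{0,1}^5` for
structured `0`-faces) says that at order four these identities — with no reference to any face — already force every essential coordinate into some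
core, i.e. a principal cap.  We record the corresponding conditional: **if every would-be counterexample (terminal hypotheses, no sure member, `E ≡ 0`)
has a principal cap, then (EQI-(n+3))** — by PCD alone, without the top criterion.  `CoreRigidity 1` is OUR CONJECTURE (weaker than `CapDichotomy 1`
as a hypothesis: it may use `E_4 ≡ 0`). [this work] -/

/-- **Core rigidity at order `n + 3`** (OUR CONJECTURE at order 4; a statement, never a fact): a terminal family with no sure member whose `E_{n+3}`
vanishes on the whole open cube has a principal cap. [this work] [status: open] -/
@[conjecture] def CoreRigidity (n : ℕ) : Prop :=
  ∀ (ι : Type) [Fintype ι] (U : Fin (n + 3) → Set (Set ι)) (S : Finset ι), (∀ j, IsUpperSet (U j)) →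
    (∀ j, (∅ : Set ι) ∉ U j) →
    (∀ j, DeterminedBy (U j) (↑S : Set ι)) →
    (∀ m : Fin (n + 3), ¬ SuppZeroFlag (n + 2) (fun j => U (m.succAbove j))) →
    (¬ ∃ e : ι, ∀ j, ∃ ω, e ∉ ω ∧ ω ∉ U j ∧ insert e ω ∈ U j) →
    (¬ ∃ e : ι, ∃ c : Fin (n + 3), (∃ ω, e ∉ ω ∧ ω ∉ U c ∧ insert e ω ∈ U c) ∧ ∀ j, j ≠ c → ¬ Affects (U j) e) →
    (∀ e ∈ S, ∀ b : Bool, SuppZeroFlag (n + 3) (fun j => secAt e b (U j))) →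
    (∀ p : ι → unitInterval, (∀ e, (p e : ℝ) ∈ Set.Ioo (0 : ℝ) 1) → sahiE (bernoulliWeight p) (n + 3) (fun j => ind (U j)) = 0) →
      HasPrincipalCap U

/-- Core rigidity implies the cap dichotomy's use: it gives (EQI-(n+3)) from (EQI-(n+2)). [this work] -/
theorem masterFamilyIdentEqIff_of_coreRigidity (n : ℕ) (hlow : MasterFamilyIdentEqIff (n + 2)) (h : CoreRigidity n) :
    MasterFamilyIdentEqIff (n + 3) := by
  refine (masterFamilyIdentEqIff_iff_terminal_all n).2 ?_
  intro ι _ U S hU hS hno hncp hnpriv hmin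
  have hne : ∀ j, U j ≠ ∅ := ne_empty_of_no_zero_subfamily U hno
  by_cases hsure : ∃ i, U i = Set.univ
  · obtain ⟨i, hi⟩ := hsure
    have hUi : ∀ j, IsUpperSet (U (i.succAbove j)) := fun j => hU _
    have hnz : ¬ ∀ p : ι → unitInterval, (∀ e, (p e : ℝ) ∈ Set.Ioo (0 : ℝ) 1) →
        sahiE (bernoulliWeight p) (n + 2) (fun j => ind (U (i.succAbove j))) = 0 :=
      fun hall => hno i ((hlow ι (fun j => U (i.succAbove j)) hUi).1 hall)
    push Not at hnz
    obtain ⟨p, hp, hpne⟩ := hnz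
    refine ⟨p, hp, ?_⟩
    rw [sahiE_eq_of_mem_univ p U i hi]
    exact mul_ne_zero (by exact_mod_cast Nat.succ_ne_zero n) hpne
  · push Not at hsure
    have h0 : ∀ j, (∅ : Set ι) ∉ U j := by
      intro j h0j
      exact hsure j (Set.eq_univ_of_forall fun ω => hU j (Set.empty_subset ω) h0j)
    by_contra hall
    push Not at hall
    have hall' : ∀ p : ι → unitInterval, (∀ e, (p e : ℝ) ∈ Set.Ioo (0 : ℝ) 1) →
        sahiE (bernoulliWeight p) (n + 2 + 1) (fun j => ind (U j)) = 0 := fun p hp => hall p hp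
    obtain ⟨c, hc⟩ := h ι U S hU h0 hS hno hncp hnpriv hmin hall'
    have hZ : SuppZeroFlag (n + 2 + 1) U :=
      (SahiSparseEnd.sahiE_eq_zero_iff_suppZeroFlag_of_principalCap U hU h0 c hc).1 hall'
    obtain ⟨i, hi, -⟩ := hZ
    exact hno i hi

/-- **(EQI-4) from core rigidity at order four.** [this work] -/
theorem masterFamilyIdentEqIff_four_of_coreRigidity (h : CoreRigidity 1) : MasterFamilyIdentEqIff 4 :=
  masterFamilyIdentEqIff_of_coreRigidity 1 masterFamilyIdentEqIff_three h

/-- The cap dichotomy implies core rigidity whenever the family has no non-splitting top corner to fall back on — more precisely, a terminal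
family with `E ≡ 0` cannot have a non-splitting top corner (TOP CRITERION), so `CapDichotomy n → CoreRigidity n`. [this work] -/
theorem coreRigidity_of_capDichotomy (n : ℕ) (h : CapDichotomy n) : CoreRigidity n := by
  intro ι _ U S hU h0 hS hno hncp hnpriv hmin hall
  rcases h ι U S hU h0 hS hno hncp hnpriv hmin with hcap | ⟨c, hc, hcmin, hns⟩
  · exact hcap
  · exfalso
    have hne : ∀ j, U j ≠ ∅ := ne_empty_of_no_zero_subfamily U hno
    have huniv : ∀ j, (Set.univ : Set ι) ∈ U j := fun j => univ_mem_of_isUpperSet_of_ne_empty (hU j) (hne j)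
    exact SahiSparseEnd.not_forall_interior_sahiE_eq_zero_of_noSplit U hU huniv c hc hcmin hns hall

end Summit.CriticalPhenomena.PercolationContinuityZ3.Theorems
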